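import Mathlib
import HarnessLib
import Literature.Combinatorics.Additive.KempermanElementaryPairs

/-!
# Grynkiewicz 2009, §4: the types (V)–(VIII), dual pairs, and the decompositions of Theorem 4.1

[cite: Grynkiewicz2009, §4 (types (V)–(VIII)); §2 (dual pair); Thm 4.1] [tag: critical-pair]
[tag: inverse-theorem]

Topic `Literature/Combinatorics/Additive`.  Cell `mm-stpp` (D-0046), seat `mm-stpp-lit` (gen 23); the
port of D. J. Grynkiewicz, *A step beyond Kemperman's structure theorem*, Mathematika **55** (2009)
67–114 continued: the VOCABULARY of Theorem 4.1 — «four more types (V)–(VIII), which will be the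
additional basic building blocks, along with the four types of elementary pairs, for constructing all
pairs `A` and `B` with `|A + B| = |A| + |B|`» (print p. 10), the «dual pair» of §2 (print p. 7), and the
conclusion of Theorem 4.1 as a structure (`IsGrynkiewiczDecomp`, modelled on `IsKempermanDecomp` of
`KempermanElementaryPairs.lean`) — so that the blocks of §6 («The Main Proof») can be typed against it.
The PRINT wording is followed (the arXiv v2 words types (V)–(VIII) differently, relative to the
quasi-period).  Plus: §6 **Claim 3** («if `|A| = 2`, then the theorem holds with type (V) and group `G`»).

SOURCE (print p. 10 = p0010 L5–L13 and Theorem 4.1 L41–L70, p. 11 L1–L2; p. 7 L11–L16; read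
2026-08-29 in the held text `paper:doi-10-1112-s0025579300000966`).
«We say the pair of nonempty, finite subsets `(A, B)` of the abelian group `G` is of type:
(V) if `min{|A|, |B|} = 2` and `|A + B| = |A| + |B|`;
(VI) if `|A| = |B| = 3`, `A = x + B` for some `x ∈ G`, and `|A + B| = |A| + |B|`;
(VII) if `(A, B)` is a dual of a type (VI) pair with respect to some finite `K ≤ G`;
(VIII) if there exists a subgroup `K ≅ ℤ/2ℤ × ℤ/2ℤ` such that `(φ_K(A), φ_K(B))` is of type (II), `A`,
`B` and `A + B` are aperiodic, and `d⊆(A, A + K) = d⊆(B, B + K) = 4` with each of the 4 end terms of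
`φ_K(A)` and `φ_K(B)` containing exactly 2 `K`-holes.  Note that `|A + B| = |A| + |B|` in all cases.»
«We say that the pair `A', B' ⊆ G` is a dual pair to `A, B ⊆ G`, with respect to `H ≤ G`, if
`A ⊆ a + H` and `B ⊆ b + H` (for some `a ∈ A` and `b ∈ B`), `(A, B)` is non-extendible, and either
`A' = g − A` and `B' = g' + (a + b + H) ∖ (A + B)` (for some `g, g' ∈ G`), or `B' = g − B` and
`A' = g' + (a + b + H) ∖ (A + B)` (for some `g, g' ∈ G`).»
«**Theorem 4.1.** Let `G` be an abelian group and let `A, B ⊆ G` be finite and nonempty with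
`|A + B| = |A| + |B|`.  If `A + B` is aperiodic, then either there exist `α, β ∈ G` such that (17)
`|(A ∪ {α}) + (B ∪ {β})| = |A ∪ {α}| + |B ∪ {β}| − 1`, or there exist quasi-periodic decompositions
`A = A₁ ∪ A₀` and `B = B₁ ∪ B₀` with common quasi-period `H` and `A₀` and `B₀` nonempty such that:
(i) `φ_H(A₀) + φ_H(B₀)` is a unique expression element in `φ_H(A) + φ_H(B)`; (ii)
`|φ_H(A) + φ_H(B)| = |φ_H(A)| + |φ_H(B)| − 1`; (iii) the pair `(A₀, B₀)` is of type (V), (VI), (VII) or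
(VIII).  If `A + B` is periodic with `H = H(A + B)`, then either (17) holds, or else `A` and `B` are
`H`-periodic, `φ_H(A + B)` is aperiodic, and `|φ_H(A) + φ_H(B)| = |φ_H(A)| + |φ_H(B)|.»
(The second part is `Grynkiewicz2009.seventeen_or_isPeriodicWith_of_addStab`,
`StepBeyondKempermanPeriodic.lean`; the first part is NOT proved in the tree — §6, pp. 23–36.)

RENDERINGS.  `g − A` is `g +ᵥ (−A)` (= `A.image (g − ·)`, `image_const_sub_eq_vadd_neg`);
`g' + (a + b + H) ∖ (A + B)` elementwise (`z − g' ∈ a + b + H`, `z − g' ∉ A + B`), as the aperiodic member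
of type (IV) in `KempermanElementaryPairs.lean`; «`K ≅ ℤ/2ℤ × ℤ/2ℤ`» as «`|K| = 4` and `2k = 0` for all
`k ∈ K`» (`K` carried with a finset `Kf`); «`(φ_K(A), φ_K(B))` is of type (II)» unfolded with named
first terms `a, b` and common difference `d`: `A + K = {a, a + d, …, a + (m−1)d} + K`,
`B + K = {b, …, b + (n−1)d} + K`, `m, n ≥ 2`, and «the order of `φ_K(d)` is at least `m + n − 1`» as
«the `m + n − 1` cosets `a + b + l d + K` are distinct» (`|{a + b, …} + K| = 4(m + n − 1)`), which also
makes `|φ_K(A)| = m`, `|φ_K(B)| = n`; «`d⊆(A, A + K) = 4`» as `|A + K| = |A| + 4`; an «end term» of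
`φ_K(A)` is the coset `a + K` or `a + (m−1)d + K`, «containing exactly 2 `K`-holes» as
`|(a + K) ∖ A| = 2`.  (i), (ii) of Theorem 4.1 exactly as (i), (ii) of `IsKempermanDecomp`.

MAIN RESULTS (5 definitions + 1 structure, reviewed; 0 named facts; API proved).
* `IsDualPair`, `IsTypeV`, `IsTypeVI`, `IsTypeVII`, `IsTypeVIII`, `IsGrynkiewiczDecomp`.
* `IsTypeV.card_add`, `IsTypeVI.card_add`, `IsTypeV.symm`, `IsTypeVI` basics; `IsDualPair.neg_add_eq`
  (Proposition 2.4 inside a coset: `−A + ((a + b + H) ∖ (A + B)) = (b + H) ∖ B`) and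
  `IsTypeVII.card_add` («Note that `|A + B| = |A| + |B|` in all cases» for (VII));
  `isGrynkiewiczDecomp_top_of_card_eq_two` (§6 Claim 3).

## References
* D. J. Grynkiewicz, *A step beyond Kemperman's structure theorem*, Mathematika 55 (2009) 67–114,
  doi:10.1112/S0025579300000966, §2 p. 7 (dual pairs), §4 p. 10 (types (V)–(VIII), Theorem 4.1), §6
  Claim 3 (p. 24) [cite: Grynkiewicz2009, Thm 4.1] — held `paper:doi-10-1112-s0025579300000966`.
-/

namespace Literature.Combinatorics.Additive

open Finset
open scoped Pointwise

universe u

variable {G : Type u} [AddCommGroup G] [DecidableEq G]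

/-! ### Dual pairs (§2, print p. 7) -/

/-- **Dual pair** (print p. 7): «We say that the pair `A', B' ⊆ G` is a dual pair to `A, B ⊆ G`, with
respect to `H ≤ G`, if `A ⊆ a + H` and `B ⊆ b + H` (for some `a ∈ A` and `b ∈ B`), `(A, B)` is
non-extendible, and either `A' = g − A` and `B' = g' + (a + b + H) ∖ (A + B)` (for some `g, g' ∈ G`),
or `B' = g − B` and `A' = g' + (a + b + H) ∖ (A + B)` (for some `g, g' ∈ G`); in other words, up to
translation, `A'` and `B'` are obtained by applying Proposition 2.4 to `A` and `B` when considered as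
subsets of `H`.»  `g − A` is `g +ᵥ (−A)`; the set `g' + (a + b + H) ∖ (A + B)` elementwise;
«`(A, B)` non-extendible» = both one-sided statements `IsNonExtendible`.
[cite: Grynkiewicz2009, §2 (dual pair, p. 7)] -/
def IsDualPair (H : AddSubgroup G) (A B A' B' : Finset G) : Prop :=
  ∃ a ∈ A, ∃ b ∈ B, (∀ x ∈ A, x - a ∈ H) ∧ (∀ y ∈ B, y - b ∈ H) ∧
    IsNonExtendible A B ∧ IsNonExtendible B A ∧
    ((∃ g g' : G, A' = g +ᵥ (-A) ∧ ∀ z, z ∈ B' ↔ (z - g') - (a + b) ∈ H ∧ z - g' ∉ A + B) ∨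
      (∃ g g' : G, B' = g +ᵥ (-B) ∧ ∀ z, z ∈ A' ↔ (z - g') - (a + b) ∈ H ∧ z - g' ∉ A + B))

/-! ### Types (V)–(VIII) (§4, print p. 10) -/

/-- **Type (V)**: «if `min{|A|, |B|} = 2` and `|A + B| = |A| + |B|`».
[cite: Grynkiewicz2009, §4 (type (V), p. 10)] -/
def IsTypeV (A B : Finset G) : Prop := min #A #B = 2 ∧ #(A + B) = #A + #B

/-- **Type (VI)**: «if `|A| = |B| = 3`, `A = x + B` for some `x ∈ G`, and `|A + B| = |A| + |B|`».
[cite: Grynkiewicz2009, §4 (type (VI), p. 10)] -/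
def IsTypeVI (A B : Finset G) : Prop :=
  #A = 3 ∧ #B = 3 ∧ (∃ x : G, A = x +ᵥ B) ∧ #(A + B) = #A + #B

/-- **Type (VII)**: «if `(A, B)` is a dual of a type (VI) pair with respect to some finite `K ≤ G`».
[cite: Grynkiewicz2009, §4 (type (VII), p. 10)] -/
def IsTypeVII (A B : Finset G) : Prop :=
  ∃ (K : AddSubgroup G) (A' B' : Finset G), (K : Set G).Finite ∧ IsTypeVI A' B' ∧ IsDualPair K A' B' A B

/-- **Type (VIII)**: «if there exists a subgroup `K ≅ ℤ/2ℤ × ℤ/2ℤ` such that `(φ_K(A), φ_K(B))` is of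
type (II), `A`, `B` and `A + B` are aperiodic, and `d⊆(A, A + K) = d⊆(B, B + K) = 4` with each of the
4 end terms of `φ_K(A)` and `φ_K(B)` containing exactly 2 `K`-holes.»  Rendering (see the module
docstring): `K` with a finset carrier `Kf`, `|K| = 4` and `k + k = 0` on `K`; type (II) of the image pair
unfolded with first terms `a ∈ A`, `b ∈ B` and common difference `d` — `A + K = {a, …, a + (m−1)d} + K`,
`B + K = {b, …, b + (n−1)d} + K`, `m, n ≥ 2`, the `m + n − 1` cosets `a + b + l d + K` pairwise
distinct («the order of `φ_K(d)` is at least `|φ_K(A)| + |φ_K(B)| − 1»); `d⊆(A, A + K) = 4` as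
`|A + K| = |A| + 4`; the end terms `a + K`, `a + (m−1)d + K`, `b + K`, `b + (n−1)d + K` each contain
exactly two elements outside `A`, resp. `B`. [cite: Grynkiewicz2009, §4 (type (VIII), p. 10)] -/
def IsTypeVIII (A B : Finset G) : Prop :=
  ¬ IsPeriodic A ∧ ¬ IsPeriodic B ∧ ¬ IsPeriodic (A + B) ∧
    ∃ (K : AddSubgroup G) (Kf : Finset G), (∀ g, g ∈ Kf ↔ g ∈ K) ∧ #Kf = 4 ∧ (∀ k ∈ K, k + k = 0) ∧
      ∃ (a b d : G) (m n : ℕ), a ∈ A ∧ b ∈ B ∧ 2 ≤ m ∧ 2 ≤ n ∧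
        A + Kf = apFinset a d m + Kf ∧ B + Kf = apFinset b d n + Kf ∧
        #(apFinset (a + b) d (m + n - 1) + Kf) = 4 * (m + n - 1) ∧
        #(A + Kf) = #A + 4 ∧ #(B + Kf) = #B + 4 ∧
        #((a +ᵥ Kf) \ A) = 2 ∧ #(((a + (m - 1) • d) +ᵥ Kf) \ A) = 2 ∧
        #((b +ᵥ Kf) \ B) = 2 ∧ #(((b + (n - 1) • d) +ᵥ Kf) \ B) = 2

/-! ### The decompositions of Theorem 4.1 -/

/-- **The conclusion of Theorem 4.1 (second alternative).**  «there exist quasi-periodic decompositions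
`A = A₁ ∪ A₀` and `B = B₁ ∪ B₀` with common quasi-period `H` and `A₀` and `B₀` nonempty such that:
(i) `φ_H(A₀) + φ_H(B₀)` is a unique expression element in `φ_H(A) + φ_H(B)`; (ii)
`|φ_H(A) + φ_H(B)| = |φ_H(A)| + |φ_H(B)| − 1`; (iii) the pair `(A₀, B₀)` is of type (V), (VI), (VII)
or (VIII).»  (i) and (ii) rendered exactly as in `IsKempermanDecomp`.
[cite: Grynkiewicz2009, Thm 4.1 (p. 10)] -/
structure IsGrynkiewiczDecomp (H : AddSubgroup G) (A B A₁ A₀ B₁ B₀ : Finset G) : Prop where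
  /-- `A = A₁ ∪ A₀` is a quasi-periodic decomposition with quasi-period `H` -/
  decomp_left : IsQuasiPeriodicDecomp H A A₁ A₀
  /-- `B = B₁ ∪ B₀` is a quasi-periodic decomposition with quasi-period `H` -/
  decomp_right : IsQuasiPeriodicDecomp H B B₁ B₀
  /-- `A₀ ≠ ∅` -/
  left_nonempty : A₀.Nonempty
  /-- `B₀ ≠ ∅` -/
  right_nonempty : B₀.Nonempty
  /-- (i) `φ_H(A₀) + φ_H(B₀)` is a unique expression element in `φ_H(A) + φ_H(B)` -/
  quot_unique : ∀ a ∈ A, ∀ b ∈ B, ∀ a₀ ∈ A₀, ∀ b₀ ∈ B₀, (a + b) - (a₀ + b₀) ∈ H →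
    a - a₀ ∈ H ∧ b - b₀ ∈ H
  /-- (ii) `|φ_H(A + B)| = |φ_H(A)| + |φ_H(B)| − 1` -/
  cosetCount_add : cosetCount H (A + B) + 1 = cosetCount H A + cosetCount H B
  /-- (iii) `(A₀, B₀)` is of type (V), (VI), (VII) or (VIII) -/
  bottom : IsTypeV A₀ B₀ ∨ IsTypeVI A₀ B₀ ∨ IsTypeVII A₀ B₀ ∨ IsTypeVIII A₀ B₀

/-! ### API: «Note that `|A + B| = |A| + |B|` in all cases» and symmetry -/

namespace IsTypeV

/-- `|A + B| = |A| + |B|` for type (V). [cite: Grynkiewicz2009, §4 (p. 10, «Note that |A + B| = |A| + |B|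
in all cases»)] -/
theorem card_add {A B : Finset G} (h : IsTypeV A B) : #(A + B) = #A + #B := h.2

/-- Type (V) is symmetric. [cite: Grynkiewicz2009, §4 (type (V))] -/
theorem symm {A B : Finset G} (h : IsTypeV A B) : IsTypeV B A :=
  ⟨by rw [min_comm]; exact h.1, by rw [add_comm, h.2, add_comm]⟩

/-- Both members of a type (V) pair have at least two elements, and one has exactly two.
[cite: Grynkiewicz2009, §4 (type (V))] -/
theorem two_le {A B : Finset G} (h : IsTypeV A B) : 2 ≤ #A ∧ 2 ≤ #B ∧ (#A = 2 ∨ #B = 2) := by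
  have := h.1
  refine ⟨by omega, by omega, ?_⟩
  rcases le_total #A #B with hle | hle
  · rw [min_eq_left hle] at this; exact Or.inl this
  · rw [min_eq_right hle] at this; exact Or.inr this

/-- A pair with `|A| = 2` or `|B| = 2`, both of size `≥ 2`, and `|A + B| = |A| + |B|` is of type (V).
[cite: Grynkiewicz2009, §4 (type (V))] -/
theorem of_card_eq_two {A B : Finset G} (h2 : #A = 2 ∨ #B = 2) (hA : 2 ≤ #A) (hB : 2 ≤ #B)
    (hAB : #(A + B) = #A + #B) : IsTypeV A B := by
  refine ⟨?_, hAB⟩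
  rcases h2 with h | h
  · rw [h, min_eq_left (h ▸ hB)]
  · rw [h, min_eq_right (h ▸ hA)]

end IsTypeV

namespace IsTypeVI

/-- `|A + B| = |A| + |B|` (`= 6`) for type (VI). [cite: Grynkiewicz2009, §4 (p. 10)] -/
theorem card_add {A B : Finset G} (h : IsTypeVI A B) : #(A + B) = #A + #B := h.2.2.2

/-- Type (VI) is symmetric (`A = x + B` iff `B = −x + A`). [cite: Grynkiewicz2009, §4 (type (VI))] -/
theorem symm {A B : Finset G} (h : IsTypeVI A B) : IsTypeVI B A := by
  obtain ⟨hA, hB, ⟨x, hx⟩, hAB⟩ := h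
  refine ⟨hB, hA, ⟨-x, by rw [hx, neg_vadd_vadd]⟩, by rw [add_comm, hAB, add_comm]⟩

/-- In a type (VI) pair the set `A` has `|2A| = 6 > 2|A| − 1` (the arXiv wording «`|2A₀| > 2|A₀| − 1`»;
«the restriction `|A + B| = |A| + |B|` … is provided to exclude critical pairs covered by KST»).
[cite: Grynkiewicz2009, §4 (type (VI), p. 10)] -/
theorem card_add_self {A B : Finset G} (h : IsTypeVI A B) : #(A + A) = 6 := by
  obtain ⟨hA, hB, ⟨x, hx⟩, hAB⟩ := h
  have : A + B = (-x) +ᵥ (A + A) := by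
    conv_lhs => rw [show B = (-x) +ᵥ A by rw [hx, neg_vadd_vadd]]
    rw [add_comm, vadd_add_assoc, add_comm]
  rw [this, card_vadd_finset] at hAB
  omega

end IsTypeVI

/-! ### Proposition 2.4 inside a coset, and `|A + B| = |A| + |B|` for type (VII) -/

namespace IsDualPair

/-- **Proposition 2.4 «when considered as subsets of `H`»**: if `A ⊆ a + H`, `B ⊆ b + H`, `B` is
non-extendible with respect to `A`, and `C = g' + (a + b + H) ∖ (A + B)` (elementwise), then
`−A + C = g' + ((b + H) ∖ B)`, elementwise: `z ∈ −A + C ↔ z − g' ∈ b + H ∧ z − g' ∉ B`.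
[cite: Grynkiewicz2009, Prop 2.4; §2 (dual pair, «obtained by applying Proposition 2.4 to A and B when
considered as subsets of H»)] -/
theorem mem_neg_add_iff {H : AddSubgroup G} {A B C : Finset G} {a b g' : G}
    (hA : ∀ x ∈ A, x - a ∈ H) (hneB : IsNonExtendible B A)
    (hC : ∀ z, z ∈ C ↔ (z - g') - (a + b) ∈ H ∧ z - g' ∉ A + B) (z : G) :
    z ∈ -A + C ↔ (z - g') - b ∈ H ∧ z - g' ∉ B := by
  constructor
  · intro hz
    obtain ⟨u, hu, c, hc, rfl⟩ := mem_add.1 hz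
    rw [mem_neg'] at hu
    obtain ⟨hcH, hcAB⟩ := (hC c).1 hc
    refine ⟨?_, fun hB => hcAB ?_⟩
    · have h3 : a - -u ∈ H := by
        have := H.neg_mem (hA (-u) hu)
        rwa [show -(-u - a) = a - -u by abel] at this
      have e : u + c - g' - b = (c - g' - (a + b)) + (a - -u) := by abel
      rw [e]
      exact H.add_mem hcH h3
    · have e : c - g' = -u + (u + c - g') := by abel
      rw [e]
      exact add_mem_add hu hB
  · rintro ⟨hzH, hzB⟩
    -- non-extendibility of `B`: some `x ∈ A` has `x + (z − g') ∉ A + B`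
    obtain ⟨x, hx, hxz⟩ : ∃ x ∈ A, x + (z - g') ∉ A + B := by
      by_contra hno
      push Not at hno
      apply hneB (z - g') hzB
      refine Subset.antisymm (fun w hw => ?_) (add_subset_add_right (subset_insert _ _))
      obtain ⟨y, hy, x, hx, rfl⟩ := mem_add.1 hw
      rw [mem_insert] at hy
      rcases hy with rfl | hy
      · rw [add_comm (z - g') x, add_comm B A]; exact hno x hx
      · exact add_mem_add hy hx
    refine mem_add.2 ⟨-x, by rw [mem_neg', neg_neg]; exact hx, x + z, (hC _).2 ⟨?_, ?_⟩, by abel⟩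
    · have e : x + z - g' - (a + b) = (x - a) + (z - g' - b) := by abel
      rw [e]; exact H.add_mem (hA x hx) hzH
    · rwa [show x + z - g' = x + (z - g') by abel]

/-- **«Note that `|A + B| = |A| + |B|` in all cases»: type (VII).**  A dual `(A, B)` of a type (VI) pair
`(A', B')` with respect to a finite `K`: `|A| + |B| = 3 + (|K| − 6)` and `A + B` is a translate of
`−A' + ((a + b + K) ∖ (A' + B'))`, i.e. of `(b + K) ∖ B'`, of size `|K| − 3` (Proposition 2.4 inside the
coset). [cite: Grynkiewicz2009, §4 (p. 10, «Note that |A + B| = |A| + |B| in all cases»)] -/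
theorem card_add_of_typeVI {K : AddSubgroup G} {A' B' A B : Finset G} (hK : (K : Set G).Finite)
    (hVI : IsTypeVI A' B') (hd : IsDualPair K A' B' A B) : #(A + B) = #A + #B := by
  obtain ⟨Kf, hKf, -⟩ := exists_finset_carrier hK
  obtain ⟨hA3, hB3, -, hAB'⟩ := hVI
  -- symmetric in the two alternatives: reduce to data `(X, Y)` = the negated and the complemented set
  have key : ∀ {X Y X' Y' : Finset G} {x y g g' : G}, x ∈ X → y ∈ Y → #X = 3 → #Y = 3 →
      #(X + Y) = #X + #Y →
      (∀ u ∈ X, u - x ∈ K) → (∀ v ∈ Y, v - y ∈ K) → IsNonExtendible Y X →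
      X' = g +ᵥ (-X) → (∀ z, z ∈ Y' ↔ (z - g') - (x + y) ∈ K ∧ z - g' ∉ X + Y) →
      #(X' + Y') = #X' + #Y' := by
    intro X Y X' Y' x y g g' hx hy hX hY hXY hXK hYK hne hX' hY'
    -- `Y' = g' + ((x + y + K) ∖ (X + Y))`, of size `|K| − 6`
    have hY'eq : Y' = ((g' + (x + y)) +ᵥ Kf) \ (g' +ᵥ (X + Y)) := by
      ext z
      rw [hY', mem_sdiff, mem_vadd_finset, mem_vadd_finset]
      constructor
      · rintro ⟨h1, h2⟩
        refine ⟨⟨z - g' - (x + y), (hKf _).2 h1, by rw [vadd_eq_add]; abel⟩, ?_⟩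
        rintro ⟨w, hw, rfl⟩
        exact h2 (by rwa [vadd_eq_add, add_sub_cancel_left])
      · rintro ⟨⟨k, hk, rfl⟩, h2⟩
        refine ⟨by rw [vadd_eq_add, show g' + (x + y) + k - g' - (x + y) = k by abel]; exact (hKf k).1 hk,
          fun h3 => h2 ⟨_, h3, by rw [vadd_eq_add]; abel⟩⟩
    have hXYsub : g' +ᵥ (X + Y) ⊆ (g' + (x + y)) +ᵥ Kf := by
      intro z hz
      obtain ⟨w, hw, rfl⟩ := mem_vadd_finset.1 hz
      obtain ⟨u, hu, v, hv, rfl⟩ := mem_add.1 hw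
      refine mem_vadd_finset.2 ⟨(u - x) + (v - y), (hKf _).2 (K.add_mem (hXK u hu) (hYK v hv)), ?_⟩
      rw [vadd_eq_add, vadd_eq_add]; abel
    have hcY' : #Y' + 6 = #Kf := by
      rw [hY'eq, card_sdiff_of_subset hXYsub, card_vadd_finset, card_vadd_finset, hXY, hX, hY]
      have : 6 ≤ #Kf := by
        have := card_le_card hXYsub
        rw [card_vadd_finset, card_vadd_finset, hXY, hX, hY] at this
        exact this
      omega
    -- `X' + Y' = (g + g') + ((y + K) ∖ Y)`, of size `|K| − 3`
    have hsum : X' + Y' = ((g + g' + y) +ᵥ Kf) \ ((g + g') +ᵥ Y) := by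
      ext z
      rw [hX', vadd_add_assoc, mem_vadd_finset, mem_sdiff, mem_vadd_finset, mem_vadd_finset]
      simp only [vadd_eq_add]
      constructor
      · rintro ⟨w, hw, rfl⟩
        obtain ⟨h1, h2⟩ := (mem_neg_add_iff hXK hne hY' w).1 hw
        refine ⟨⟨w - g' - y, (hKf _).2 h1, by abel⟩, ?_⟩
        rintro ⟨v, hv, hvw⟩
        apply h2
        have : w - g' = v := by
          have e : w = g' + v := add_left_cancel (hvw.symm.trans (by abel))
          rw [e, add_sub_cancel_left]
        rwa [this]
      · rintro ⟨⟨k, hk, rfl⟩, h2⟩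
        refine ⟨g' + y + k, (mem_neg_add_iff hXK hne hY' _).2 ⟨?_, fun h3 => h2 ⟨_, h3, ?_⟩⟩, ?_⟩
        · rw [show g' + y + k - g' - y = k by abel]; exact (hKf k).1 hk
        · abel
        · abel
    have hYsub : (g + g') +ᵥ Y ⊆ (g + g' + y) +ᵥ Kf := by
      intro z hz
      obtain ⟨v, hv, rfl⟩ := mem_vadd_finset.1 hz
      exact mem_vadd_finset.2 ⟨v - y, (hKf _).2 (hYK v hv), by rw [vadd_eq_add, vadd_eq_add]; abel⟩
    rw [hsum, card_sdiff_of_subset hYsub, card_vadd_finset, card_vadd_finset, hY, hX', card_vadd_finset,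
      card_neg, hX]
    omega
  obtain ⟨a, ha, b, hb, hAK, hBK, hneA, hneB, halt⟩ := hd
  rcases halt with ⟨g, g', hAeq, hBiff⟩ | ⟨g, g', hBeq, hAiff⟩
  · exact key ha hb hA3 hB3 hAB' hAK hBK hneB hAeq hBiff
  · have hBA' : #(B' + A') = #B' + #A' := by rw [add_comm, hAB', add_comm]
    have hAiff' : ∀ z, z ∈ A ↔ (z - g') - (b + a) ∈ K ∧ z - g' ∉ B' + A' := fun z => by
      rw [add_comm b a, add_comm B' A']; exact hAiff z
    have := key hb ha hB3 hA3 hBA' hBK hAK hneA hBeq hAiff'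
    rw [add_comm] at this; omega

end IsDualPair

/-- **«Note that `|A + B| = |A| + |B|` in all cases»: type (VII).**
[cite: Grynkiewicz2009, §4 (p. 10)] -/
theorem IsTypeVII.card_add {A B : Finset G} (h : IsTypeVII A B) : #(A + B) = #A + #B := by
  obtain ⟨K, A', B', hK, hVI, hd⟩ := h
  exact IsDualPair.card_add_of_typeVI hK hVI hd

/-! ### §6, Claim 3: `|A| = 2` -/

/-- **§6, Claim 3** («If `|A| = 1`, then `|A + B| = |A| + |B|` cannot hold, and if `|A| = 2`, then the
theorem holds with type (V) and group `G`»): in a nontrivial group, `|A| = 2` and `|A + B| = |A| + |B|`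
give the decomposition of Theorem 4.1 with quasi-period `G`, `A₀ = A`, `B₀ = B` of type (V) (`|B| ≥ 2`
is forced). [cite: Grynkiewicz2009, §6 Claim 3 (proof of Thm 4.1, p. 24)] -/
theorem isGrynkiewiczDecomp_top_of_card_eq_two {A B : Finset G} (hG : (⊤ : AddSubgroup G) ≠ ⊥)
    (hA : #A = 2) (hAB : #(A + B) = #A + #B) : IsGrynkiewiczDecomp ⊤ A B ∅ A ∅ B := by
  have hAne : A.Nonempty := card_pos.1 (by omega)
  have hBne : B.Nonempty := by
    rw [nonempty_iff_ne_empty]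
    rintro rfl
    rw [add_empty, card_empty] at hAB
    omega
  have hB2 : 2 ≤ #B := by
    by_contra hlt
    obtain ⟨b, rfl⟩ : ∃ b, B = {b} := card_eq_one.1 (by have := card_pos.2 hBne; omega)
    rw [card_add_singleton, card_singleton] at hAB
    omega
  refine ⟨IsQuasiPeriodicDecomp.top A hG, IsQuasiPeriodicDecomp.top B hG, hAne, hBne,
    fun _ _ _ _ _ _ _ _ _ => ⟨AddSubgroup.mem_top _, AddSubgroup.mem_top _⟩, ?_,
    Or.inl (IsTypeV.of_card_eq_two (Or.inl hA) (by omega) hB2 hAB)⟩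
  rw [cosetCount_eq_one_of_sub_mem (hAne.add hBne) fun _ _ _ _ => AddSubgroup.mem_top _,
    cosetCount_eq_one_of_sub_mem hAne fun _ _ _ _ => AddSubgroup.mem_top _,
    cosetCount_eq_one_of_sub_mem hBne fun _ _ _ _ => AddSubgroup.mem_top _]

/-- Claim 3 with the roles exchanged: `|B| = 2`. [cite: Grynkiewicz2009, §6 Claim 3] -/
theorem isGrynkiewiczDecomp_top_of_card_eq_two' {A B : Finset G} (hG : (⊤ : AddSubgroup G) ≠ ⊥)
    (hB : #B = 2) (hAB : #(A + B) = #A + #B) : IsGrynkiewiczDecomp ⊤ A B ∅ A ∅ B := by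
  have hBne : B.Nonempty := card_pos.1 (by omega)
  have hAne : A.Nonempty := by
    rw [nonempty_iff_ne_empty]
    rintro rfl
    rw [empty_add, card_empty] at hAB
    omega
  have hA2 : 2 ≤ #A := by
    by_contra hlt
    obtain ⟨a, rfl⟩ : ∃ a, A = {a} := card_eq_one.1 (by have := card_pos.2 hAne; omega)
    rw [card_singleton_add, card_singleton] at hAB
    omega
  refine ⟨IsQuasiPeriodicDecomp.top A hG, IsQuasiPeriodicDecomp.top B hG, hAne, hBne,
    fun _ _ _ _ _ _ _ _ _ => ⟨AddSubgroup.mem_top _, AddSubgroup.mem_top _⟩, ?_,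
    Or.inl (IsTypeV.of_card_eq_two (Or.inr hB) hA2 (by omega) hAB)⟩
  rw [cosetCount_eq_one_of_sub_mem (hAne.add hBne) fun _ _ _ _ => AddSubgroup.mem_top _,
    cosetCount_eq_one_of_sub_mem hAne fun _ _ _ _ => AddSubgroup.mem_top _,
    cosetCount_eq_one_of_sub_mem hBne fun _ _ _ _ => AddSubgroup.mem_top _]


/-! ### Invariance under translation and under interchanging the summands

«We may assume w.l.o.g. that `0 ∈ A ∩ B`» (§6, first line of the proof of Theorem 4.1) and the
symmetric roles of `A` and `B` («w.l.o.g. `|A| ≥ |B|`», Claim 9): the types (V)–(VIII), dual pairs and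
the decompositions of Theorem 4.1 are invariant under `(A, B) ↦ (g + A, g' + B)` and `(A, B) ↦ (B, A)`.
[cite: Grynkiewicz2009, §6 (proof of Thm 4.1, «We may assume w.l.o.g. that 0 ∈ A ∩ B»; Claim 9)] -/

section Invariance

/-- `(g + A) + (g' + B) = (g + g') + (A + B)` (a copy of the private `vadd_finset_add_vadd_finset` of
`KempermanElementaryPairs.lean`). [cite: Grynkiewicz2009, §2] -/
private theorem vadd_add_vadd_eq' (A B : Finset G) (g g' : G) :
    (g +ᵥ A) + (g' +ᵥ B) = (g + g') +ᵥ (A + B) := by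
  rw [vadd_add_assoc, add_comm A (g' +ᵥ B), vadd_add_assoc, vadd_vadd, add_comm B A]

/-- Type (V) is translation invariant. [cite: Grynkiewicz2009, §4 (type (V)); §6 («w.l.o.g. 0 ∈ A ∩ B»)] -/
theorem IsTypeV.vadd {A B : Finset G} (h : IsTypeV A B) (g g' : G) :
    IsTypeV (g +ᵥ A) (g' +ᵥ B) := by
  refine ⟨by rw [card_vadd_finset, card_vadd_finset]; exact h.1, ?_⟩
  rw [vadd_add_vadd_eq', card_vadd_finset, card_vadd_finset, card_vadd_finset]
  exact h.2

/-- Type (VI) is translation invariant. [cite: Grynkiewicz2009, §4 (type (VI)); §6] -/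
theorem IsTypeVI.vadd {A B : Finset G} (h : IsTypeVI A B) (g g' : G) :
    IsTypeVI (g +ᵥ A) (g' +ᵥ B) := by
  obtain ⟨hA, hB, ⟨x, hx⟩, hAB⟩ := h
  refine ⟨by rw [card_vadd_finset]; exact hA, by rw [card_vadd_finset]; exact hB,
    ⟨g + x - g', ?_⟩, ?_⟩
  · rw [hx, vadd_vadd, vadd_vadd, show g + x - g' + g' = g + x by abel]
  · rw [vadd_add_vadd_eq', card_vadd_finset, card_vadd_finset, card_vadd_finset]
    exact hAB

namespace IsDualPair

/-- A dual pair stays a dual pair of the same `(A, B)` after translating its two members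
(«up to translation»). [cite: Grynkiewicz2009, §2 (dual pair, p. 7)] -/
theorem vadd_right {H : AddSubgroup G} {A B A' B' : Finset G} (h : IsDualPair H A B A' B')
    (g g' : G) : IsDualPair H A B (g +ᵥ A') (g' +ᵥ B') := by
  obtain ⟨a, ha, b, hb, hAH, hBH, hneA, hneB, halt⟩ := h
  refine ⟨a, ha, b, hb, hAH, hBH, hneA, hneB, ?_⟩
  rcases halt with ⟨c, c', hA', hB'⟩ | ⟨c, c', hB', hA'⟩
  · left
    refine ⟨g + c, g' + c', by rw [hA', vadd_vadd], fun z => ?_⟩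
    rw [← neg_vadd_mem_iff, hB', vadd_eq_add]
    have e : -g' + z - c' = z - (g' + c') := by abel
    rw [e]
  · right
    refine ⟨g' + c, g + c', by rw [hB', vadd_vadd], fun z => ?_⟩
    rw [← neg_vadd_mem_iff, hA', vadd_eq_add]
    have e : -g + z - c' = z - (g + c') := by abel
    rw [e]

/-- Duality is symmetric in the two coordinates: a dual pair `(A', B')` of `(A, B)` gives the dual pair
`(B', A')` of `(B, A)`. [cite: Grynkiewicz2009, §2 (dual pair, p. 7)] -/
theorem symm {H : AddSubgroup G} {A B A' B' : Finset G} (h : IsDualPair H A B A' B') :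
    IsDualPair H B A B' A' := by
  obtain ⟨a, ha, b, hb, hAH, hBH, hneA, hneB, halt⟩ := h
  refine ⟨b, hb, a, ha, hBH, hAH, hneB, hneA, ?_⟩
  rcases halt with ⟨c, c', hA', hB'⟩ | ⟨c, c', hB', hA'⟩
  · right
    refine ⟨c, c', hA', fun z => ?_⟩
    rw [hB', add_comm b a, add_comm B A]
  · left
    refine ⟨c, c', hB', fun z => ?_⟩
    rw [hA', add_comm b a, add_comm B A]

end IsDualPair

/-- Type (VII) is translation invariant. [cite: Grynkiewicz2009, §4 (type (VII)); §6] -/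
theorem IsTypeVII.vadd {A B : Finset G} (h : IsTypeVII A B) (g g' : G) :
    IsTypeVII (g +ᵥ A) (g' +ᵥ B) := by
  obtain ⟨K, A', B', hK, hVI, hd⟩ := h
  exact ⟨K, A', B', hK, hVI, hd.vadd_right g g'⟩

/-- Type (VII) is symmetric. [cite: Grynkiewicz2009, §4 (type (VII))] -/
theorem IsTypeVII.symm {A B : Finset G} (h : IsTypeVII A B) : IsTypeVII B A := by
  obtain ⟨K, A', B', hK, hVI, hd⟩ := h
  exact ⟨K, B', A', hK, hVI.symm, hd.symm⟩

/-- Type (VIII) is translation invariant (translate the first terms `a`, `b`; `K`, `d`, `m`, `n` are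
kept). [cite: Grynkiewicz2009, §4 (type (VIII)); §6] -/
theorem IsTypeVIII.vadd {A B : Finset G} (h : IsTypeVIII A B) (g g' : G) :
    IsTypeVIII (g +ᵥ A) (g' +ᵥ B) := by
  obtain ⟨hAp, hBp, hABp, K, Kf, hKf, hK4, hK2, a, b, d, m, n, ha, hb, hm, hn, hAK, hBK, hord,
    hcA, hcB, he1, he2, he3, he4⟩ := h
  refine ⟨by rwa [isPeriodic_vadd_iff], by rwa [isPeriodic_vadd_iff],
    by rw [vadd_add_vadd_eq', isPeriodic_vadd_iff]; exact hABp,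
    K, Kf, hKf, hK4, hK2, g + a, g' + b, d, m, n, vadd_mem_vadd_finset ha, vadd_mem_vadd_finset hb,
    hm, hn, ?_, ?_, ?_, ?_, ?_, ?_, ?_, ?_, ?_⟩
  · rw [vadd_add_assoc, hAK, ← vadd_apFinset, vadd_add_assoc]
  · rw [vadd_add_assoc, hBK, ← vadd_apFinset, vadd_add_assoc]
  · rw [show g + a + (g' + b) = (g + g') + (a + b) by abel, ← vadd_apFinset, vadd_add_assoc,
      card_vadd_finset, hord]
  · rw [vadd_add_assoc, card_vadd_finset, card_vadd_finset, hcA]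
  · rw [vadd_add_assoc, card_vadd_finset, card_vadd_finset, hcB]
  · rw [← vadd_vadd, ← vadd_finset_sdiff, card_vadd_finset, he1]
  · rw [show g + a + (m - 1) • d = g + (a + (m - 1) • d) by abel, ← vadd_vadd, ← vadd_finset_sdiff,
      card_vadd_finset, he2]
  · rw [← vadd_vadd, ← vadd_finset_sdiff, card_vadd_finset, he3]
  · rw [show g' + b + (n - 1) • d = g' + (b + (n - 1) • d) by abel, ← vadd_vadd, ← vadd_finset_sdiff,
      card_vadd_finset, he4]

/-- Type (VIII) is symmetric. [cite: Grynkiewicz2009, §4 (type (VIII))] -/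
theorem IsTypeVIII.symm {A B : Finset G} (h : IsTypeVIII A B) : IsTypeVIII B A := by
  obtain ⟨hAp, hBp, hABp, K, Kf, hKf, hK4, hK2, a, b, d, m, n, ha, hb, hm, hn, hAK, hBK, hord,
    hcA, hcB, he1, he2, he3, he4⟩ := h
  refine ⟨hBp, hAp, by rw [add_comm]; exact hABp, K, Kf, hKf, hK4, hK2, b, a, d, n, m, hb, ha, hn, hm,
    hBK, hAK, ?_, hcB, hcA, he3, he4, he1, he2⟩
  rw [add_comm b a, show n + m - 1 = m + n - 1 by omega]
  exact hord

/-- The disjunction «of type (V), (VI), (VII) or (VIII)» is translation invariant.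
[cite: Grynkiewicz2009, §6 («We may assume w.l.o.g. that 0 ∈ A ∩ B»)] -/
theorem isTypeV_or_vadd {A B : Finset G}
    (h : IsTypeV A B ∨ IsTypeVI A B ∨ IsTypeVII A B ∨ IsTypeVIII A B) (g g' : G) :
    IsTypeV (g +ᵥ A) (g' +ᵥ B) ∨ IsTypeVI (g +ᵥ A) (g' +ᵥ B) ∨ IsTypeVII (g +ᵥ A) (g' +ᵥ B) ∨
      IsTypeVIII (g +ᵥ A) (g' +ᵥ B) := by
  rcases h with h | h | h | h
  · exact Or.inl (h.vadd g g')
  · exact Or.inr (Or.inl (h.vadd g g'))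
  · exact Or.inr (Or.inr (Or.inl (h.vadd g g')))
  · exact Or.inr (Or.inr (Or.inr (h.vadd g g')))

/-- The disjunction «of type (V), (VI), (VII) or (VIII)» is symmetric.
[cite: Grynkiewicz2009, §6 (Claim 9, «w.l.o.g.»)] -/
theorem isTypeV_or_symm {A B : Finset G}
    (h : IsTypeV A B ∨ IsTypeVI A B ∨ IsTypeVII A B ∨ IsTypeVIII A B) :
    IsTypeV B A ∨ IsTypeVI B A ∨ IsTypeVII B A ∨ IsTypeVIII B A := by
  rcases h with h | h | h | h
  · exact Or.inl h.symm
  · exact Or.inr (Or.inl h.symm)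
  · exact Or.inr (Or.inr (Or.inl h.symm))
  · exact Or.inr (Or.inr (Or.inr h.symm))

namespace IsGrynkiewiczDecomp

variable {H : AddSubgroup G} {A B A₁ A₀ B₁ B₀ : Finset G}

/-- The decompositions of Theorem 4.1 are symmetric in the two summands.
[cite: Grynkiewicz2009, Thm 4.1; §6 (Claim 9)] -/
theorem symm (h : IsGrynkiewiczDecomp H A B A₁ A₀ B₁ B₀) : IsGrynkiewiczDecomp H B A B₁ B₀ A₁ A₀ where
  decomp_left := h.decomp_right
  decomp_right := h.decomp_left
  left_nonempty := h.right_nonempty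
  right_nonempty := h.left_nonempty
  quot_unique := fun b hb a ha b₀ hb₀ a₀ ha₀ hq =>
    (h.quot_unique a ha b hb a₀ ha₀ b₀ hb₀ (by rw [add_comm a b, add_comm a₀ b₀]; exact hq)).symm
  cosetCount_add := by rw [add_comm B A, h.cosetCount_add, add_comm]
  bottom := isTypeV_or_symm h.bottom

/-- The decompositions of Theorem 4.1 are translation invariant.
[cite: Grynkiewicz2009, Thm 4.1; §6 («We may assume w.l.o.g. that 0 ∈ A ∩ B»)] -/
theorem vadd (h : IsGrynkiewiczDecomp H A B A₁ A₀ B₁ B₀) (g g' : G) :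
    IsGrynkiewiczDecomp H (g +ᵥ A) (g' +ᵥ B) (g +ᵥ A₁) (g +ᵥ A₀) (g' +ᵥ B₁) (g' +ᵥ B₀) where
  decomp_left := h.decomp_left.vadd g
  decomp_right := h.decomp_right.vadd g'
  left_nonempty := h.left_nonempty.vadd_finset
  right_nonempty := h.right_nonempty.vadd_finset
  quot_unique := by
    intro a ha b hb a₀ ha₀ b₀ hb₀ hq
    obtain ⟨a', ha', rfl⟩ := mem_vadd_finset.1 ha
    obtain ⟨b', hb', rfl⟩ := mem_vadd_finset.1 hb
    obtain ⟨a₀', ha₀', rfl⟩ := mem_vadd_finset.1 ha₀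
    obtain ⟨b₀', hb₀', rfl⟩ := mem_vadd_finset.1 hb₀
    have e : (g +ᵥ a') + (g' +ᵥ b') - ((g +ᵥ a₀') + (g' +ᵥ b₀')) = a' + b' - (a₀' + b₀') := by
      simp only [vadd_eq_add]; abel
    rw [e] at hq
    have := h.quot_unique a' ha' b' hb' a₀' ha₀' b₀' hb₀' hq
    simp only [vadd_eq_add, add_sub_add_left_eq_sub]
    exact this
  cosetCount_add := by
    rw [vadd_add_vadd_eq', cosetCount_vadd, cosetCount_vadd, cosetCount_vadd, h.cosetCount_add]
  bottom := isTypeV_or_vadd h.bottom g g'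

end IsGrynkiewiczDecomp

/-- «We may assume w.l.o.g. that `0 ∈ A ∩ B`»: the second alternative of Theorem 4.1 for translates
`(−a + A, −b + B)` gives it for `(A, B)`. [cite: Grynkiewicz2009, §6 (proof of Thm 4.1, first line)] -/
theorem exists_isGrynkiewiczDecomp_of_vadd {A B : Finset G} {a b : G}
    (h : ∃ (H : AddSubgroup G) (A₁ A₀ B₁ B₀ : Finset G),
      IsGrynkiewiczDecomp H ((-a) +ᵥ A) ((-b) +ᵥ B) A₁ A₀ B₁ B₀) :
    ∃ (H : AddSubgroup G) (A₁ A₀ B₁ B₀ : Finset G), IsGrynkiewiczDecomp H A B A₁ A₀ B₁ B₀ := by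
  obtain ⟨H, A₁, A₀, B₁, B₀, hd⟩ := h
  refine ⟨H, a +ᵥ A₁, a +ᵥ A₀, b +ᵥ B₁, b +ᵥ B₀, ?_⟩
  have := hd.vadd a b
  rwa [vadd_neg_vadd, vadd_neg_vadd] at this

/-- (17) is translation invariant: from the translates `(−a + A, −b + B)` back to `(A, B)`.
[cite: Grynkiewicz2009, §6 (proof of Thm 4.1, first line)] -/
theorem seventeen_of_vadd {A B : Finset G} {a b : G}
    (h : ∃ α β : G, #(insert α ((-a) +ᵥ A) + insert β ((-b) +ᵥ B)) + 1 =
      #(insert α ((-a) +ᵥ A)) + #(insert β ((-b) +ᵥ B))) :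
    ∃ α β : G, #(insert α A + insert β B) + 1 = #(insert α A) + #(insert β B) := by
  obtain ⟨α, β, h⟩ := h
  refine ⟨a + α, b + β, ?_⟩
  have hA : insert (a + α) A = a +ᵥ insert α ((-a) +ᵥ A) := by
    rw [vadd_finset_insert, vadd_neg_vadd, vadd_eq_add]
  have hB : insert (b + β) B = b +ᵥ insert β ((-b) +ᵥ B) := by
    rw [vadd_finset_insert, vadd_neg_vadd, vadd_eq_add]
  rw [hA, hB, vadd_add_vadd_eq', card_vadd_finset, card_vadd_finset, card_vadd_finset]
  exact h

end Invariance

end Literature.Combinatorics.Additive
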